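import Literature.NumberTheory.IwasawaTheory.ClassicalMuVanishesUnramifiedClassesProofs
import Mathlib.GroupTheory.PGroup
import HarnessLib

/-!
# Rank growth in a cyclic extension of prime degree: `rank_p B ≤ p · (2 · rank_p A + c)` from the number of ambiguous classes
# (finite abelian groups; the group-theoretic half of Iwasawa's 1973 ascent of `μ = 0`, proved; no definition, no named fact)

`Proofs`-style file (theorems only) in topic `NumberTheory/NumberFields` (namespace
`Literature.NumberTheory.NumberFields.CyclicRankBound`), written by the prover seat `cruxlead-stmt-BirchSwinnertonDyer-19573-w2` GEN 7
(cell `bsd-2adic`; `--supports` stmt-BirchSwinnertonDyer-19573; closes nothing). It is module (G) of the seat's «Iwasawa ℓ = 2 ascent with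
real places» (μ = 0 ascends along a cyclic degree-`p` extension `F/K` of number fields whenever the archimedean factor of Chevalley's
ambiguous class number formula is cancelled by the unit signatures — e.g. `K = ℚ(P)` cubic with one real place): the PURELY GROUP-THEORETIC
step from the count of ambiguous classes to the `p`-RANK of the class group of the top field.

SETTING (multiplicative, as for `ClassGroup`). `A`, `B` finite commutative groups (think `Cl(K)`, `Cl(F)`), `σ : B →* B` with `σ^[p] = id`
(a generator of `Gal(F/K) ≅ C_p` acting on `Cl(F)`), `j : A →* B` and `N : B →* A` with `N (j a) = a^p` (extension and norm of ideal classes,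
Neukirch III (1.6) (ii)) and `σ (j a) = j a`; `S = {b | σ b = b}` the ambiguous classes; `rank_p X = ord_p #(X / X^p)` (the tree's
`classGroupPRank` currency; `= log_p #X[p]`, §1).

* §1 (private helpers) `#X[n] = #(X/Xⁿ)`, `#X[p] = p^{rank_p X}`.
* §2 **`natCard_le_pow_natCard_ker_of_iterate`** — a NILPOTENT endomorphism `D` of a finite commutative group `V` with `D^[n] = 1` has
  `#V ≤ (#ker D)^n` (the layers `ker D^{i+1}/ker D^i` embed in `ker D`); **`iterate_div_id_eq_one_of_pow_eq_one`** — for `σ^[p] = id`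
  and `v^p = 1`, `D = σ/id` has `D^[p] v = 1` (Frobenius: `(σ − 1)^p ≡ σ^p − 1 (mod p)`, tree `sub_one_pow_prime_pow_apply_of_torsion`
  through `Additive`); hence **`natCard_pTorsion_le_pow_natCard_fixed_pTorsion`**: `#B[p] ≤ (#B[p]^σ)^p`.
* §3 `ker_le_ker_powMonoidHom_of_norm` (capitulation kernel `⊆ A[p]`), `natCard_quotient_range_pow_map_le` (`rank_p j(A) ≤ rank_p A`),
  and the assembly **`padicValNat_card_quotient_le_of_fixed`**:
  `ord_p #S ≤ ord_p #A + c ⟹ rank_p B ≤ p · (2 · rank_p A + c)`.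

Number-theoretic use (separate files): with Chevalley's formula `#S · p · [E_K : E_K ∩ N Fˣ] = h_K · ∏ e_𝔭 · ∏_{v∣∞} e_v` the hypothesis reads
`c = t − 1 + ord_p(∏_{v∣∞} e_v) − ord_p [E_K : E_K ∩ N Fˣ]`, i.e. `c = t − 1` for `p` odd, and also for `p = 2` when the units of `K` take every
sign pattern at the real places ramified in `F` (the `2^ρ` of `∏ e_v` is then a factor of the unit index); along a `ℤ_p`-tower with `μ(K) = 0`
(`rank_p Cl(K_n)` bounded, tree `exists_forall_classGroupPRank_le_of_classicalMuVanishes`) this bounds `rank_p Cl(F_n)`, whence `μ(F) = 0`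
(tree `classicalMuVanishes_of_forall_classGroupPRank_le`).

References: [Iwasawa1973MuInvariants] K. Iwasawa, *On the μ-invariants of ℤ_ℓ-extensions* (1973), Thm. 2 (cyclic of degree ℓ; the
structure of the argument — ambiguous classes, then the whole module); [Washington1997] §13.3 Prop. 13.23 («μ = 0 ⟺ rank A_n bounded»),
Lemma 13.27-type counting; [Lang1990] Ch. 13 §4 Lemma 4.1 (Chevalley); [Gras2003] IV.4 (genus theory: invariant classes vs. classes
from the base, capitulation kernel killed by the degree); [NeukirchANT1999] Ch. III §1 Prop. (1.6) (ii) (`N ∘ i = [L:K]`).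
-/

set_option autoImplicit false

noncomputable section

open scoped Classical

namespace Literature.NumberTheory.NumberFields.CyclicRankBound

/-! ## §1 `p`-torsion versus the cokernel of the `p`-th power map -/

section Torsion

variable (X : Type*) [CommGroup X] [Finite X]

/-- **`#X[n] = #(X / Xⁿ)`** for a finite commutative group: both equal `#X / #Xⁿ` (`X / X[n] ≅ Xⁿ`). [folklore] -/
private theorem natCard_ker_powMonoidHom_eq_natCard_quotient (n : ℕ) :
    Nat.card (powMonoidHom n : X →* X).ker = Nat.card (X ⧸ (powMonoidHom n : X →* X).range) := by
  have h1 := Subgroup.card_eq_card_quotient_mul_card_subgroup ((powMonoidHom n : X →* X).range)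
  have h2 := Subgroup.card_eq_card_quotient_mul_card_subgroup ((powMonoidHom n : X →* X).ker)
  have h3 : Nat.card (X ⧸ (powMonoidHom n : X →* X).ker) = Nat.card (powMonoidHom n : X →* X).range :=
    Nat.card_congr (QuotientGroup.quotientKerEquivRange (powMonoidHom n : X →* X)).toEquiv
  rw [h3] at h2
  have hpos : 0 < Nat.card (powMonoidHom n : X →* X).range := Nat.card_pos
  have h := h1.symm.trans h2
  rw [mul_comm] at h
  exact (Nat.eq_of_mul_eq_mul_left hpos h).symm

omit [Finite X] in
/-- The `p`-torsion of a commutative group is a `p`-group. [folklore] -/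
private theorem isPGroup_ker_powMonoidHom (p : ℕ) [Fact p.Prime] : IsPGroup p (powMonoidHom p : X →* X).ker := by
  intro x
  refine ⟨1, Subtype.ext ?_⟩
  rw [pow_one, SubgroupClass.coe_pow, OneMemClass.coe_one]
  exact x.2

/-- **`#X[p] = p ^ rank_p X`** with `rank_p X = ord_p #(X / Xᵖ)` (the tree's `classGroupPRank` currency). [folklore]
[cite: Washington1997, §13.3 (proof of Prop. 13.23: `rank A = dim A/pA = dim A[p]`)] -/
private theorem natCard_ker_powMonoidHom_eq_pow (p : ℕ) [Fact p.Prime] :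
    Nat.card (powMonoidHom p : X →* X).ker = p ^ padicValNat p (Nat.card (X ⧸ (powMonoidHom p : X →* X).range)) := by
  obtain ⟨k, hk⟩ := (isPGroup_ker_powMonoidHom X p).exists_card_eq
  rw [← natCard_ker_powMonoidHom_eq_natCard_quotient, hk, padicValNat.prime_pow]

end Torsion

/-! ## §2 Nilpotent endomorphisms; the operator `σ/id` on the `p`-torsion -/

section Nilpotent

universe u

/-- **A nilpotent endomorphism bounds the order by its kernel**: if `D : V →* V` satisfies `D^[n] = 1` on a finite commutative group `V`,
then `#V ≤ (#ker D)^n` — `#V = #ker D · #D(V)` and `D` restricts to a endomorphism of `D(V)` with `D^[n-1] = 1`.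
[cite: Washington1997, §13.3 (proof of Thm. 13.13: filtration by the kernels of the powers of a nilpotent operator)] [folklore] -/
theorem natCard_le_pow_natCard_ker_of_iterate (n : ℕ) :
    ∀ (V : Type u) [CommGroup V] [Finite V] (D : V →* V), (∀ v : V, D^[n] v = 1) → Nat.card V ≤ Nat.card D.ker ^ n := by
  induction n with
  | zero =>
    intro V _ _ D hD
    haveI : Subsingleton V := ⟨fun a b ↦ by rw [show a = 1 from hD a, show b = 1 from hD b]⟩
    rw [pow_zero]
    exact (Nat.card_of_subsingleton (1 : V)).le
  | succ n ih =>
    intro V _ _ D hD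
    -- `D` restricted to its range
    have hmap : ∀ x : D.range, D (x : V) ∈ D.range := fun x ↦ ⟨x, rfl⟩
    let D' : D.range →* D.range :=
      { toFun := fun x ↦ ⟨D (x : V), hmap x⟩
        map_one' := Subtype.ext (by simp)
        map_mul' := fun x y ↦ Subtype.ext (by simp) }
    have hD'coe : ∀ (k : ℕ) (x : D.range), ((D'^[k] x : D.range) : V) = D^[k] (x : V) := by
      intro k
      induction k with
      | zero => intro x; rfl
      | succ k ihk =>
        intro x
        rw [Function.iterate_succ_apply', Function.iterate_succ_apply', ← ihk x]
        rfl
    have hD' : ∀ x : D.range, D'^[n] x = 1 := by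
      intro x
      obtain ⟨v, hv⟩ := x.2
      apply Subtype.ext
      rw [hD'coe, OneMemClass.coe_one, ← hv, ← Function.iterate_succ_apply, hD v]
    have h1 := ih D.range D' hD'
    -- `ker D' ↪ ker D`
    have h2 : Nat.card D'.ker ≤ Nat.card D.ker := by
      refine Nat.card_le_card_of_injective (fun x ↦ ⟨((x : D.range) : V), ?_⟩) ?_
      · have hx : D' x = 1 := x.2
        rw [MonoidHom.mem_ker]
        exact congrArg (fun y : D.range ↦ (y : V)) hx
      · intro x y hxy
        apply Subtype.ext; apply Subtype.ext
        simpa using congrArg (fun z : D.ker ↦ (z : V)) hxy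
    -- `#V = #ker D · #range D`
    have h3 : Nat.card V = Nat.card D.ker * Nat.card D.range := by
      rw [Subgroup.card_eq_card_quotient_mul_card_subgroup D.ker, mul_comm,
        Nat.card_congr (QuotientGroup.quotientKerEquivRange D).toEquiv]
    rw [h3, pow_succ, mul_comm]
    exact Nat.mul_le_mul (h1.trans (Nat.pow_le_pow_left h2 n)) le_rfl

variable {B : Type*} [CommGroup B]

/-- `(σ/id) v = σ v / v`. [folklore] -/
private theorem div_id_apply (σ : B →* B) (v : B) : (σ / MonoidHom.id B) v = σ v / v := rfl

/-- **Frobenius for the operator `σ − 1` on the `p`-torsion (multiplicative form).** If `σ^[p] = id` on the commutative group `B` and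
`v^p = 1`, then `(σ/id)^[p] v = 1`: in `End(Additive B)`, `(σ − 1)^p v = (σ^p − 1) v = 0` because `p v = 0`
(tree `ClassicalMuVanishesUnramifiedClasses.sub_one_pow_prime_pow_apply_of_torsion`). [cite: Washington1997, §13.2 ((1+T)^{pⁿ} − 1)] [folklore] -/
theorem iterate_div_id_eq_one_of_pow_eq_one (p : ℕ) [Fact p.Prime] (σ : B →* B) (hσ : ∀ b : B, σ^[p] b = b)
    {v : B} (hv : v ^ p = 1) : (⇑(σ / MonoidHom.id B))^[p] v = 1 := by
  set φ : AddMonoid.End (Additive B) := MonoidHom.toAdditive σ with hφ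
  have hφapp : ∀ c : Additive B, φ c = Additive.ofMul (σ (Additive.toMul c)) := fun _ ↦ rfl
  -- `(φ - 1)^k c = ofMul (D^[k] v)`
  have hiter : ∀ (k : ℕ) (w : B), ((φ - 1) ^ k) (Additive.ofMul w) = Additive.ofMul ((⇑(σ / MonoidHom.id B))^[k] w) := by
    intro k
    induction k with
    | zero => intro w; rfl
    | succ k ih =>
      intro w
      rw [pow_succ, AddMonoid.End.coe_mul, Function.comp_apply, Function.iterate_succ_apply]
      have h1 : (φ - 1) (Additive.ofMul w) = Additive.ofMul ((σ / MonoidHom.id B) w) := rfl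
      rw [h1, ih]
  have hφpow : ∀ (k : ℕ) (w : B), (φ ^ k) (Additive.ofMul w) = Additive.ofMul (σ^[k] w) := by
    intro k
    induction k with
    | zero => intro w; rfl
    | succ k ih =>
      intro w
      rw [pow_succ, AddMonoid.End.coe_mul, Function.comp_apply, Function.iterate_succ_apply, hφapp, toMul_ofMul, ih]
  have hc : (p : ℤ) • Additive.ofMul v = 0 := by
    rw [natCast_zsmul, ← ofMul_pow, hv, ofMul_one]
  have key := Literature.NumberTheory.IwasawaTheory.ClassicalMuVanishesUnramifiedClasses.sub_one_pow_prime_pow_apply_of_torsion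
    (A := Additive B) p φ 1 hc
  rw [pow_one, hiter, hφpow, hσ, sub_self] at key
  exact Additive.ofMul.injective key

end Nilpotent

/-! ## §3 Capitulation, ranks of images, and the rank bound from the ambiguous classes -/

section Assembly

variable {A B : Type*} [CommGroup A] [CommGroup B] [Finite A] [Finite B] (p : ℕ) [Fact p.Prime]

omit [Finite A] [Finite B] [Fact p.Prime] in
/-- **The capitulation kernel is killed by `p`**: if `N (j a) = a^p` for all `a`, then `ker j ≤ A[p]`.
[cite: NeukirchANT1999, Ch. III §1 Prop. (1.6) (ii) (`N_{L|K}(i(𝔞)) = 𝔞^{[L:K]}`)] [cite: Gras2003, IV.4] -/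
theorem ker_le_ker_powMonoidHom_of_norm (j : A →* B) (N : B →* A) (hNj : ∀ a : A, N (j a) = a ^ p) :
    j.ker ≤ (powMonoidHom p : A →* A).ker := by
  intro a ha
  rw [MonoidHom.mem_ker] at ha ⊢
  rw [powMonoidHom_apply, ← hNj, ha, map_one]

omit [Finite B] [Fact p.Prime] in
/-- **`rank_p j(A) ≤ rank_p A`** (`j(A)` finite as a quotient of `A`): `A / Aᵖ ↠ j(A) / j(A)ᵖ`. [folklore] -/
private theorem natCard_quotient_range_pow_map_le (j : A →* B) :
    Nat.card (j.range ⧸ (powMonoidHom p : j.range →* j.range).range) ≤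
      Nat.card (A ⧸ (powMonoidHom p : A →* A).range) := by
  haveI : Finite j.range := Finite.of_surjective j.rangeRestrict j.rangeRestrict_surjective
  let f : A ⧸ (powMonoidHom p : A →* A).range →* j.range ⧸ (powMonoidHom p : j.range →* j.range).range :=
    QuotientGroup.map _ _ j.rangeRestrict (by
      rintro _ ⟨a, rfl⟩
      exact ⟨j.rangeRestrict a, by rw [powMonoidHom_apply, powMonoidHom_apply, map_pow]⟩)
  refine Nat.card_le_card_of_surjective f fun q ↦ ?_
  obtain ⟨y, rfl⟩ := QuotientGroup.mk_surjective q
  obtain ⟨a, ha⟩ := j.rangeRestrict_surjective y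
  exact ⟨QuotientGroup.mk a, by rw [QuotientGroup.map_mk, ha]⟩

/-- The number of elements of a finite group all of whose elements satisfy `x^p = 1` divides... is at most `p ^ ord_p` of the order of
any finite group it embeds in: for a `p`-subgroup `H ≤ Q`, `#H ≤ p ^ ord_p #Q`. [folklore] -/
private theorem natCard_le_pow_padicValNat_of_isPGroup {Q : Type*} [Group Q] [Finite Q] (H : Subgroup Q) (hH : IsPGroup p H) :
    Nat.card H ≤ p ^ padicValNat p (Nat.card Q) := by
  have hpr : p.Prime := Fact.out
  obtain ⟨k, hk⟩ := hH.exists_card_eq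
  have hdvd : p ^ k ∣ Nat.card Q := hk ▸ Subgroup.card_subgroup_dvd_card H
  rw [hk]
  exact Nat.pow_le_pow_right hpr.pos ((padicValNat_dvd_iff_le Nat.card_pos.ne').1 hdvd)

/-- **RANK BOUND FROM THE AMBIGUOUS CLASSES.** `A`, `B` finite commutative groups, `σ : B →* B` with `σ^[p] = id`, `j : A →* B`, `N : B →* A`
with `N ∘ j = (·)^p` and `σ ∘ j = j`; `S = {b | σ b = b}` (`MonoidHom.eqLocus σ id`). If `ord_p #S ≤ ord_p #A + c` then
**`rank_p B ≤ p · (2 · rank_p A + c)`** (`rank_p X = ord_p #(X / Xᵖ)`). Proof: `#B[p] ≤ (#S[p])^p` (§2: `σ/id` is nilpotent of order `p`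
on `B[p]` with kernel `S[p]`); `S[p] / j(A)[p] ↪ S / j(A)`, a `p`-subgroup of a group of order `#S / #j(A)`, so
`log_p #S[p] ≤ rank_p j(A) + ord_p #S − ord_p #j(A) ≤ rank_p A + (ord_p #A + c) − (ord_p #A − ord_p #ker j) ≤ 2 rank_p A + c`
(`ker j ≤ A[p]`). This is the group-theoretic content of Iwasawa's ascent of `μ = 0` along a cyclic extension of degree `p` (applied layer by
layer with Chevalley's count of `#S`). [cite: Iwasawa1973MuInvariants, Thm. 2 (structure of the argument)] [cite: Gras2003, IV.4 (genus theory)]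
[cite: Washington1997, §13.3 Prop. 13.23] -/
theorem padicValNat_card_quotient_le_of_fixed (σ : B →* B) (hσ : ∀ b : B, σ^[p] b = b)
    (j : A →* B) (N : B →* A) (hNj : ∀ a : A, N (j a) = a ^ p) (hjfix : ∀ a : A, σ (j a) = j a)
    (c : ℕ) (hfix : padicValNat p (Nat.card (σ.eqLocus (MonoidHom.id B))) ≤ padicValNat p (Nat.card A) + c) :
    padicValNat p (Nat.card (B ⧸ (powMonoidHom p : B →* B).range)) ≤
      p * (2 * padicValNat p (Nat.card (A ⧸ (powMonoidHom p : A →* A).range)) + c) := by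
  have hpr : p.Prime := Fact.out
  set S : Subgroup B := σ.eqLocus (MonoidHom.id B) with hSdef
  have hmemS : ∀ b : B, b ∈ S ↔ σ b = b := fun b ↦ Iff.rfl
  set J : Subgroup B := j.range with hJdef
  have hJS : J ≤ S := by
    rintro _ ⟨a, rfl⟩
    exact (hmemS _).2 (hjfix a)
  set rA : ℕ := padicValNat p (Nat.card (A ⧸ (powMonoidHom p : A →* A).range)) with hrA
  set rB : ℕ := padicValNat p (Nat.card (B ⧸ (powMonoidHom p : B →* B).range)) with hrB
  -- the `p`-torsion subgroups and their orders
  set Bp : Subgroup B := (powMonoidHom p : B →* B).ker with hBp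
  set Sp : Subgroup S := (powMonoidHom p : S →* S).ker with hSp
  set Jp : Subgroup J := (powMonoidHom p : J →* J).ker with hJp
  have hcardBp : Nat.card Bp = p ^ rB := natCard_ker_powMonoidHom_eq_pow B p
  have hcardAp : Nat.card (powMonoidHom p : A →* A).ker = p ^ rA := natCard_ker_powMonoidHom_eq_pow A p
  obtain ⟨s, hs⟩ := (isPGroup_ker_powMonoidHom S p).exists_card_eq
  obtain ⟨sJ, hsJ⟩ := (isPGroup_ker_powMonoidHom J p).exists_card_eq
  -- (1) `#B[p] ≤ (#S[p])^p`: the nilpotent operator `σ/id` on `B[p]`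
  have hBpmap : ∀ v : Bp, (σ / MonoidHom.id B) (v : B) ∈ Bp := fun v ↦ by
    have hv : (v : B) ^ p = 1 := v.2
    show ((σ / MonoidHom.id B) (v : B)) ^ p = 1
    rw [div_id_apply, div_pow, ← map_pow, hv, map_one, div_one]
  let Dp : Bp →* Bp :=
    { toFun := fun v ↦ ⟨(σ / MonoidHom.id B) (v : B), hBpmap v⟩
      map_one' := Subtype.ext (by simp)
      map_mul' := fun x y ↦ Subtype.ext (by simp [map_mul]) }
  have hDpcoe : ∀ (k : ℕ) (v : Bp), ((Dp^[k] v : Bp) : B) = (⇑(σ / MonoidHom.id B))^[k] (v : B) := by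
    intro k
    induction k with
    | zero => intro v; rfl
    | succ k ihk =>
      intro v
      rw [Function.iterate_succ_apply', Function.iterate_succ_apply', ← ihk v]
      rfl
  have hDpnil : ∀ v : Bp, Dp^[p] v = 1 := fun v ↦ by
    apply Subtype.ext
    rw [hDpcoe, OneMemClass.coe_one]
    exact iterate_div_id_eq_one_of_pow_eq_one p σ hσ v.2
  have h1 : Nat.card Bp ≤ Nat.card Dp.ker ^ p := natCard_le_pow_natCard_ker_of_iterate p Bp Dp hDpnil
  -- `ker Dp ↪ S[p]`
  have h2 : Nat.card Dp.ker ≤ Nat.card Sp := by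
    refine Nat.card_le_card_of_injective (fun v ↦ ⟨⟨((v : Bp) : B), ?_⟩, ?_⟩) ?_
    · -- `σ v = v`
      have hv : Dp v = 1 := v.2
      have hv' : (σ / MonoidHom.id B) ((v : Bp) : B) = 1 := congrArg (fun y : Bp ↦ (y : B)) hv
      rw [div_id_apply, div_eq_one] at hv'
      exact (hmemS _).2 hv'
    · show (⟨((v : Bp) : B), _⟩ : S) ^ p = 1
      apply Subtype.ext
      rw [SubgroupClass.coe_pow, OneMemClass.coe_one]
      exact (v : Bp).2
    · intro x y hxy
      apply Subtype.ext; apply Subtype.ext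
      have := congrArg (fun z : Sp ↦ ((z : S) : B)) hxy
      exact this
  -- (2) `#S[p] ≤ #J[p] · p ^ (ord_p #S − ord_p #J)` through `S[p] → S ⧸ J`
  set J' : Subgroup S := J.subgroupOf S with hJ'
  have hcardJ' : Nat.card J' = Nat.card J := Nat.card_congr (Subgroup.subgroupOfEquivOfLe hJS).toEquiv
  let π : Sp →* S ⧸ J' := (QuotientGroup.mk' J').comp Sp.subtype
  have hπker : Nat.card π.ker ≤ Nat.card Jp := by
    refine Nat.card_le_card_of_injective (fun v ↦ ⟨⟨((v : Sp) : S), ?_⟩, ?_⟩) ?_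
    · have hv : π v = 1 := v.2
      have hv' : ((v : Sp) : S) ∈ J' := by
        rw [MonoidHom.comp_apply, QuotientGroup.mk'_apply, QuotientGroup.eq_one_iff] at hv
        exact hv
      exact Subgroup.mem_subgroupOf.1 hv'
    · have h := (v : Sp).2
      change ((v : Sp) : S) ^ p = 1 at h
      show (⟨(((v : Sp) : S) : B), _⟩ : J) ^ p = 1
      apply Subtype.ext
      rw [SubgroupClass.coe_pow, OneMemClass.coe_one]
      have h' := congrArg (fun z : S ↦ (z : B)) h
      simpa only [SubgroupClass.coe_pow, OneMemClass.coe_one] using h'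
    · intro x y hxy
      apply Subtype.ext; apply Subtype.ext; apply Subtype.ext
      exact congrArg (fun z : Jp ↦ ((z : J) : B)) hxy
  have hπrange : Nat.card π.range ≤ p ^ padicValNat p (Nat.card (S ⧸ J')) := by
    refine natCard_le_pow_padicValNat_of_isPGroup p π.range ?_
    rintro ⟨_, v, rfl⟩
    refine ⟨1, Subtype.ext ?_⟩
    rw [pow_one, SubgroupClass.coe_pow, OneMemClass.coe_one, ← map_pow]
    have hv : v ^ p = 1 := by
      have h := v.2
      change (v : S) ^ p = 1 at h
      exact Subtype.ext (by rw [SubgroupClass.coe_pow, OneMemClass.coe_one]; exact h)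
    rw [hv, map_one]
  have h3 : Nat.card Sp ≤ Nat.card Jp * p ^ padicValNat p (Nat.card (S ⧸ J')) := by
    have h := Subgroup.card_eq_card_quotient_mul_card_subgroup π.ker
    rw [Nat.card_congr (QuotientGroup.quotientKerEquivRange π).toEquiv] at h
    rw [h, mul_comm]
    exact Nat.mul_le_mul hπker hπrange
  -- (3) `#J[p] ≤ p ^ rank_p A`
  have h4 : Nat.card Jp ≤ p ^ rA := by
    rw [hJp, natCard_ker_powMonoidHom_eq_natCard_quotient]
    have h := natCard_quotient_range_pow_map_le p j
    have hcardA : Nat.card (A ⧸ (powMonoidHom p : A →* A).range) = p ^ rA := by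
      rw [← natCard_ker_powMonoidHom_eq_natCard_quotient, hcardAp]
    rw [hcardA] at h
    exact h
  -- (4) `ord_p #(S/J) ≤ c + rank_p A` (capitulation kernel `≤ A[p]`)
  have hvS : padicValNat p (Nat.card S) = padicValNat p (Nat.card (S ⧸ J')) + padicValNat p (Nat.card J) := by
    rw [Subgroup.card_eq_card_quotient_mul_card_subgroup J', hcardJ',
      padicValNat.mul (Nat.card_pos.ne') (Nat.card_pos.ne')]
  have hvA : padicValNat p (Nat.card A) = padicValNat p (Nat.card j.ker) + padicValNat p (Nat.card J) := by
    rw [Subgroup.card_eq_card_quotient_mul_card_subgroup j.ker, mul_comm,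
      Nat.card_congr (QuotientGroup.quotientKerEquivRange j).toEquiv,
      padicValNat.mul (Nat.card_pos.ne') (Nat.card_pos.ne')]
  have hvker : padicValNat p (Nat.card j.ker) ≤ rA := by
    have hdvd : Nat.card j.ker ∣ p ^ rA := by
      rw [← hcardAp]
      exact Subgroup.card_dvd_of_le (ker_le_ker_powMonoidHom_of_norm p j N hNj)
    obtain ⟨i, hi, hi'⟩ := (Nat.dvd_prime_pow hpr).1 hdvd
    rw [hi', padicValNat.prime_pow]
    exact hi
  have h5 : padicValNat p (Nat.card (S ⧸ J')) ≤ c + rA := by omega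
  -- (5) assemble
  have h6 : Nat.card Sp ≤ p ^ (2 * rA + c) := by
    calc Nat.card Sp ≤ Nat.card Jp * p ^ padicValNat p (Nat.card (S ⧸ J')) := h3
      _ ≤ p ^ rA * p ^ (c + rA) := Nat.mul_le_mul h4 (Nat.pow_le_pow_right hpr.pos h5)
      _ = p ^ (2 * rA + c) := by rw [← pow_add]; ring_nf
  have h7 : p ^ rB ≤ p ^ (p * (2 * rA + c)) := by
    calc p ^ rB = Nat.card Bp := hcardBp.symm
      _ ≤ Nat.card Dp.ker ^ p := h1
      _ ≤ Nat.card Sp ^ p := Nat.pow_le_pow_left h2 p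
      _ ≤ (p ^ (2 * rA + c)) ^ p := Nat.pow_le_pow_left h6 p
      _ = p ^ (p * (2 * rA + c)) := by rw [← pow_mul, mul_comm]
  exact (Nat.pow_le_pow_iff_right hpr.one_lt).1 h7

end Assembly

end Literature.NumberTheory.NumberFields.CyclicRankBound

end
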